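import Summits.QuantumFields.BalabanUV.T4Continuum.Support.NE7K1LinSchurLineU1EnergyBounds

/-!
# NE7K1LinSchurLineU1SetDeriv — row NE7 (node U5), candidate route HOM, path H1L, cell K1-lin(s): B4 COROLLARY 2.3 (2.30), THE THREE
# DERIVATIVE PAIRINGS, FOR THE TWO-CUTOFF LINE ON EVERY UNION OF BLOCKS — the `L²` set-to-set bounds for `D_μG(s)`, `G(s)D_ν^⊤` and
# `D_μG(s)D_ν^⊤` (`G(s) = (twoCutoffLine s)⁻¹`), EVERY `s ∈ [0,1]`, EVERY mesh, constants `(d, L, a)` only — completing file 86's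
# first pairing to the full printed list «|⟨f,Gf′⟩|, |⟨f,D_μGf′⟩|, |⟨f,GD_ν^*f′⟩|, |⟨f,D_μGD_ν^*f′⟩|»

Lineage `b2b-balaban-t4-ne7-p2` (CRUX PROVER NE7 #2), generation 78; file 93.  b04's `B4Cor23Zero` §D–§E for the line: the solution of
`𝒫(s)v̂ = (g, 0)` has coarse part `G(s)g` (file 85 `inv_extOpR_mulVec_inl`), so files 91–92's energy bounds and extraction lemmas on the
extended system give the three set-to-set bounds with b04's constants at `σ = min(2,a)∕L^{d+1}`, and one common constant
`c_L = 4(1 + 4∕σ)(1 + 1∕σ)` dominates all four.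

* §1 `twoCutoff_inv_eq_ext_inl` (the coarse part of `𝒫(s)⁻¹(g,0)` is `G(s)g`), **`twoCutoff_dinv_setDecay`**, **`twoCutoff_invT_setDecay`**,
  **`twoCutoff_dinvT_setDecay`**.
* §2 `cL`, `consts_le_cL_sq`, **`cor23_line_pairings_set`** (all four pairings, set form, one constant `c_L·e^{−δρ₀}`).
* §3 **`cor23_line_main`**: the PRINTED quantifier shape — one pair `(c_L(d,L,a₋), lineRate(d,L,a±))` for every mesh, `s ∈ [0,1]`, `a ∈ [a₋,a₊]`,
  region, `f, f′`, `μ, ν`; numerical instance `c_L = 4420`.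

HONEST FRAMING: [folklore]; A = 0; the `δG(Ω,Ω₀)` clause of the Corollary is NOT here (the (RW) series' `NE7K1LinWalkLineDelta`); nothing
printed asserted; no `sorry`.  Census only; NE7 NOT PRINTED ∕ NOT PROVED; spine 0∕9; FIXED FINITE T⁴, rung (B)+1; NOT infinite volume, NOT
mass gap, NOT Clay.  HONEST DEPENDENCY: continuum YM on T⁴ ⇐ BetaPertH ∧ nine spine estimates (0/9 proved); BetaPertH ⇐ (D1) ∧ (D4) ∧
CAP+tail; G-an2-4 gates asym, D1 and NE2/3/4.
-/

noncomputable section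

open Finset Matrix

namespace Summit.QuantumFields.BalabanUV.T4Continuum.NE7K1LinSchurLineU1SetDeriv

open Literature.MathematicalPhysics.QuantumFieldTheory.Balaban1983to89
open Literature.MathematicalPhysics.QuantumFieldTheory.Balaban1983to89.B4Reflection242
open Literature.MathematicalPhysics.QuantumFieldTheory.Balaban1983to89.B4Lower18
open Literature.MathematicalPhysics.QuantumFieldTheory.Balaban1983to89.B4Cor23Zero (fdiff fdiffT fdiff_zero fdiffT_zero l2n
  abs_dot_le_of_setSq)
open NE7K1LinSchurLineForm NE7K1LinBlockCoords NE7K1LinSchurLineU1 NE7K1LinTwoRunMonotone NE7K1LinSchurLineU1Set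
open NE7K1LinSchurLineSetDecay NE7K1LinSchurLineU1Energy

variable {d : ℕ}

/-! ### §1 The three derivative set-to-set bounds -/

section SetDecay

variable {n L : ℕ} [NeZero L] {R' : Finset (Fin (d + 1) → ℤ)}

/-- **THE COARSE PART OF `𝒫(s)⁻¹(g, 0)` IS `G(s)g`** (`G(s) = (twoCutoffLine s)⁻¹`; file 85's block-inverse identity on vectors).
[folklore] -/
theorem twoCutoff_inv_eq_ext_inl (hn : 1 ≤ n) (hR' : IsBlockUnion (n * L) R') {a : ℝ} (ha : 0 < a) {s : ℝ} (hs0 : 0 ≤ s)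
    (g : ↥(R'.image (blk L)) → ℝ) :
    (fun x => ((extU1 (isBlockUnion_fine hR') n a s)⁻¹.mulVec (Sum.elim g 0)) (Sum.inl x)) =
      (twoCutoffLine (isBlockUnion_fine hR') n a s)⁻¹.mulVec g := by
  funext x
  have hS : IsUnit (twoCutoffLine (isBlockUnion_fine hR') n a s).det :=
    isUnit_det_of_coercive _ (lt_min (by norm_num) ha) (twoCutoffLine_coercive_sharp hn hR' ha hs0)
  exact inv_extOpR_mulVec_inl _ _ _ _ _ hs0 (runB₂₂_isUnit hn hR' ha) hS g x

/-- **SET-TO-SET DECAY OF `D_μG(s)`**: `Σ_{x∈S}(D_μ(twoCutoffLine s)⁻¹g)(x)² ≤ (8∕σ)(1 + 4δ²∕σ)e^{−2δρ₀}Σg²`, `σ = min(2,a)∕L^{d+1}`, for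
`supp g ⊆ T`, `dist_η(S,T) ≥ ρ₀`, every `s ∈ [0,1]`, every mesh. [cite: CombesThomas1973, §II] [folklore] -/
theorem twoCutoff_dinv_setDecay (hn : 1 ≤ n) (hR' : IsBlockUnion (n * L) R') {a δ : ℝ} (ha : 0 < a) (hδ0 : 0 ≤ δ) (hδ1 : δ ≤ 1)
    (hsmall : 2 * (2 * ((d : ℝ) + 1) * (δ * L) ^ 2 + a * (Real.exp δ - 1)) ≤ (min 2 a / (L : ℝ) ^ (d + 1)) / 2)
    {s : ℝ} (hs0 : 0 ≤ s) (hs1 : s ≤ 1) (S T : Finset ↥(R'.image (blk L))) (ρ₀ : ℝ)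
    (hρ₀ : ∀ x ∈ S, ∀ t ∈ T, ρ₀ ≤ edistR n (R'.image (blk L)) x t)
    (g : ↥(R'.image (blk L)) → ℝ) (hg : ∀ x, x ∉ T → g x = 0) (μ : Fin (d + 1)) :
    ∑ x ∈ S, fdiff n (R'.image (blk L)) μ ((twoCutoffLine (isBlockUnion_fine hR') n a s)⁻¹.mulVec g) x ^ 2 ≤
      8 / (min 2 a / (L : ℝ) ^ (d + 1)) * (1 + 4 * δ ^ 2 / (min 2 a / (L : ℝ) ^ (d + 1))) * Real.exp (-(2 * (δ * ρ₀))) *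
        ∑ x, g x ^ 2 := by
  have hL0 : (0 : ℝ) < L := by exact_mod_cast (NeZero.one_le : 1 ≤ L)
  have hσ : 0 < min 2 a / (L : ℝ) ^ (d + 1) := div_pos (lt_min (by norm_num) ha) (by positivity)
  by_cases hT : T.Nonempty
  · set v := (extU1 (isBlockUnion_fine hR') n a s)⁻¹.mulVec (Sum.elim g 0) with hv
    set w : ↥(R'.image (blk L)) ⊕ (↥(R'.image (blk L)) × NZ d L) → ℝ := fun j => Real.exp (rhoT n δ T hT j) * v j with hw
    have hE := energyA_ext hn hR' ha hδ0 hδ1 hsmall hs0 hs1 T hT g hg w (fun j => rfl)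
    have hS := sum_fdiff_sq_le_extEnergy hn hR' ha hδ0 hδ1 hs0 hs1 T hT S ρ₀ hρ₀ v w (fun j => rfl) μ
    have hcoarse : (v ∘ Sum.inl) = (twoCutoffLine (isBlockUnion_fine hR') n a s)⁻¹.mulVec g :=
      twoCutoff_inv_eq_ext_inl hn hR' ha hs0 g
    rw [hcoarse] at hS
    calc _ ≤ _ := hS
      _ ≤ 2 * Real.exp (-(2 * (δ * ρ₀))) * (1 + 4 * δ ^ 2 / (min 2 a / (L : ℝ) ^ (d + 1))) *
            (4 / (min 2 a / (L : ℝ) ^ (d + 1)) * ∑ x, g x ^ 2) := mul_le_mul_of_nonneg_left hE (by positivity)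
      _ = _ := by ring
  · have hg0 : g = 0 := funext fun x => hg x fun hx => hT ⟨x, hx⟩
    rw [hg0, Matrix.mulVec_zero, fdiff_zero]
    simp only [Pi.zero_apply]
    norm_num

/-- **SET-TO-SET DECAY OF `G(s)D_ν^⊤`**: `Σ_{x∈S}((twoCutoffLine s)⁻¹D_ν^⊤f′)(x)² ≤ (8∕σ)(1 + 4δ²∕σ)e^{−2δρ₀}Σf′²` for `supp f′ ⊆ T` — uniform in
the mesh although `‖D^⊤f′‖ ∼ n‖f′‖`. [cite: CombesThomas1973, §II] [folklore] -/
theorem twoCutoff_invT_setDecay (hn : 1 ≤ n) (hR' : IsBlockUnion (n * L) R') {a δ : ℝ} (ha : 0 < a) (hδ0 : 0 ≤ δ) (hδ1 : δ ≤ 1)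
    (hsmall : 2 * (2 * ((d : ℝ) + 1) * (δ * L) ^ 2 + a * (Real.exp δ - 1)) ≤ (min 2 a / (L : ℝ) ^ (d + 1)) / 2)
    {s : ℝ} (hs0 : 0 ≤ s) (hs1 : s ≤ 1) (S T : Finset ↥(R'.image (blk L))) (ρ₀ : ℝ)
    (hρ₀ : ∀ x ∈ S, ∀ t ∈ T, ρ₀ ≤ edistR n (R'.image (blk L)) x t) (ν : Fin (d + 1))
    (f' : ↥(R'.image (blk L)) → ℝ) (hf' : ∀ x, x ∉ T → f' x = 0) :
    ∑ x ∈ S, ((twoCutoffLine (isBlockUnion_fine hR') n a s)⁻¹.mulVec (fdiffT n (R'.image (blk L)) ν f')) x ^ 2 ≤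
      8 / (min 2 a / (L : ℝ) ^ (d + 1)) * (1 + 4 * δ ^ 2 / (min 2 a / (L : ℝ) ^ (d + 1))) * Real.exp (-(2 * (δ * ρ₀))) *
        ∑ x, f' x ^ 2 := by
  have hL0 : (0 : ℝ) < L := by exact_mod_cast (NeZero.one_le : 1 ≤ L)
  have hσ : 0 < min 2 a / (L : ℝ) ^ (d + 1) := div_pos (lt_min (by norm_num) ha) (by positivity)
  by_cases hT : T.Nonempty
  · set v := (extU1 (isBlockUnion_fine hR') n a s)⁻¹.mulVec (Sum.elim (fdiffT n (R'.image (blk L)) ν f') 0) with hv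
    set w : ↥(R'.image (blk L)) ⊕ (↥(R'.image (blk L)) × NZ d L) → ℝ := fun j => Real.exp (rhoT n δ T hT j) * v j with hw
    have hE := energyB_ext hn hR' ha hδ0 hδ1 hsmall hs0 hs1 T hT ν f' hf' w (fun j => rfl)
    have hS := sum_sq_le_extEnergy hn hR' ha hδ0 hs0 hs1 T hT S ρ₀ hρ₀ v w (fun j => rfl)
    have hcoarse : (v ∘ Sum.inl) = (twoCutoffLine (isBlockUnion_fine hR') n a s)⁻¹.mulVec (fdiffT n (R'.image (blk L)) ν f') :=
      twoCutoff_inv_eq_ext_inl hn hR' ha hs0 _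
    rw [hcoarse] at hS
    calc _ ≤ _ := hS
      _ ≤ Real.exp (-(2 * (δ * ρ₀))) / (min 2 a / (L : ℝ) ^ (d + 1)) *
            (8 * (1 + 4 * δ ^ 2 / (min 2 a / (L : ℝ) ^ (d + 1))) * ∑ x, f' x ^ 2) := mul_le_mul_of_nonneg_left hE (by positivity)
      _ = _ := by ring
  · have h0 : f' = 0 := funext fun x => hf' x fun hx => hT ⟨x, hx⟩
    rw [h0, fdiffT_zero, Matrix.mulVec_zero]
    simp only [Pi.zero_apply]
    norm_num

/-- **SET-TO-SET DECAY OF `D_μG(s)D_ν^⊤`**: `Σ_{x∈S}(D_μ(twoCutoffLine s)⁻¹D_ν^⊤f′)(x)² ≤ 16(1 + 4δ²∕σ)²e^{−2δρ₀}Σf′²`.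
[cite: CombesThomas1973, §II] [folklore] -/
theorem twoCutoff_dinvT_setDecay (hn : 1 ≤ n) (hR' : IsBlockUnion (n * L) R') {a δ : ℝ} (ha : 0 < a) (hδ0 : 0 ≤ δ) (hδ1 : δ ≤ 1)
    (hsmall : 2 * (2 * ((d : ℝ) + 1) * (δ * L) ^ 2 + a * (Real.exp δ - 1)) ≤ (min 2 a / (L : ℝ) ^ (d + 1)) / 2)
    {s : ℝ} (hs0 : 0 ≤ s) (hs1 : s ≤ 1) (S T : Finset ↥(R'.image (blk L))) (ρ₀ : ℝ)
    (hρ₀ : ∀ x ∈ S, ∀ t ∈ T, ρ₀ ≤ edistR n (R'.image (blk L)) x t) (μ ν : Fin (d + 1))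
    (f' : ↥(R'.image (blk L)) → ℝ) (hf' : ∀ x, x ∉ T → f' x = 0) :
    ∑ x ∈ S, fdiff n (R'.image (blk L)) μ
        ((twoCutoffLine (isBlockUnion_fine hR') n a s)⁻¹.mulVec (fdiffT n (R'.image (blk L)) ν f')) x ^ 2 ≤
      16 * (1 + 4 * δ ^ 2 / (min 2 a / (L : ℝ) ^ (d + 1))) ^ 2 * Real.exp (-(2 * (δ * ρ₀))) * ∑ x, f' x ^ 2 := by
  have hL0 : (0 : ℝ) < L := by exact_mod_cast (NeZero.one_le : 1 ≤ L)
  have hσ : 0 < min 2 a / (L : ℝ) ^ (d + 1) := div_pos (lt_min (by norm_num) ha) (by positivity)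
  by_cases hT : T.Nonempty
  · set v := (extU1 (isBlockUnion_fine hR') n a s)⁻¹.mulVec (Sum.elim (fdiffT n (R'.image (blk L)) ν f') 0) with hv
    set w : ↥(R'.image (blk L)) ⊕ (↥(R'.image (blk L)) × NZ d L) → ℝ := fun j => Real.exp (rhoT n δ T hT j) * v j with hw
    have hE := energyB_ext hn hR' ha hδ0 hδ1 hsmall hs0 hs1 T hT ν f' hf' w (fun j => rfl)
    have hS := sum_fdiff_sq_le_extEnergy hn hR' ha hδ0 hδ1 hs0 hs1 T hT S ρ₀ hρ₀ v w (fun j => rfl) μ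
    have hcoarse : (v ∘ Sum.inl) = (twoCutoffLine (isBlockUnion_fine hR') n a s)⁻¹.mulVec (fdiffT n (R'.image (blk L)) ν f') :=
      twoCutoff_inv_eq_ext_inl hn hR' ha hs0 _
    rw [hcoarse] at hS
    calc _ ≤ _ := hS
      _ ≤ 2 * Real.exp (-(2 * (δ * ρ₀))) * (1 + 4 * δ ^ 2 / (min 2 a / (L : ℝ) ^ (d + 1))) *
            (8 * (1 + 4 * δ ^ 2 / (min 2 a / (L : ℝ) ^ (d + 1))) * ∑ x, f' x ^ 2) := mul_le_mul_of_nonneg_left hE (by positivity)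
      _ = _ := by ring
  · have h0 : f' = 0 := funext fun x => hf' x fun hx => hT ⟨x, hx⟩
    rw [h0, fdiffT_zero, Matrix.mulVec_zero, fdiff_zero]
    simp only [Pi.zero_apply]
    norm_num

end SetDecay

/-! ### §2 One constant for all four pairings: (2.30) for the line in set form -/

/-- **THE CONSTANT `c_L` OF (2.30) FOR THE LINE**: `c_L(σ) = 4(1 + 4∕σ)(1 + 1∕σ)` at `σ = min(2,a)∕L^{d+1}` (b04's `c₀(a)` with `min(2,a) ↦ σ`).
[folklore] -/
def cL (σ : ℝ) : ℝ := 4 * (1 + 4 / σ) * (1 + 1 / σ)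

/-- `c_L > 0`. [folklore] -/
theorem cL_pos {σ : ℝ} (hσ : 0 < σ) : 0 < cL σ := by unfold cL; positivity

/-- the four constants are dominated by `c_L²` (`0 ≤ δ ≤ 1`). [folklore] -/
theorem consts_le_cL_sq {σ δ : ℝ} (hσ : 0 < σ) (hδ0 : 0 ≤ δ) (hδ1 : δ ≤ 1) :
    (2 / σ) ^ 2 ≤ cL σ ^ 2 ∧ 8 / σ * (1 + 4 * δ ^ 2 / σ) ≤ cL σ ^ 2 ∧ 16 * (1 + 4 * δ ^ 2 / σ) ^ 2 ≤ cL σ ^ 2 := by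
  set t : ℝ := 1 / σ with ht
  have ht0 : 0 < t := by positivity
  have hδ2 : δ ^ 2 ≤ 1 := by nlinarith
  have e1 : 2 / σ = 2 * t := by rw [ht]; ring
  have e2 : 8 / σ = 8 * t := by rw [ht]; ring
  have e3 : 4 * δ ^ 2 / σ = 4 * δ ^ 2 * t := by rw [ht]; ring
  have e4 : cL σ = 4 * (1 + 4 * t) * (1 + t) := by unfold cL; rw [ht]; ring
  have hA : 1 + 4 * δ ^ 2 * t ≤ 1 + 4 * t := by nlinarith
  have hA0 : 0 ≤ 1 + 4 * δ ^ 2 * t := by positivity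
  rw [e1, e2, e3, e4]
  refine ⟨by nlinarith, ?_, ?_⟩
  · calc 8 * t * (1 + 4 * δ ^ 2 * t) ≤ 8 * t * (1 + 4 * t) := mul_le_mul_of_nonneg_left hA (by positivity)
      _ ≤ 16 * (1 + 4 * t) ^ 2 * (1 + t) ^ 2 := by
          have h1 : 8 * t ≤ 16 * (1 + 4 * t) * (1 + t) ^ 2 := by nlinarith [sq_nonneg t]
          have h2 : 0 ≤ 1 + 4 * t := by positivity
          calc 8 * t * (1 + 4 * t) = (8 * t) * (1 + 4 * t) := by ring
            _ ≤ (16 * (1 + 4 * t) * (1 + t) ^ 2) * (1 + 4 * t) := mul_le_mul_of_nonneg_right h1 h2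
            _ = 16 * (1 + 4 * t) ^ 2 * (1 + t) ^ 2 := by ring
      _ = (4 * (1 + 4 * t) * (1 + t)) ^ 2 := by ring
  · calc 16 * (1 + 4 * δ ^ 2 * t) ^ 2 ≤ 16 * (1 + 4 * t) ^ 2 :=
          mul_le_mul_of_nonneg_left (pow_le_pow_left₀ hA0 hA 2) (by norm_num)
      _ = 16 * (1 + 4 * t) ^ 2 * 1 := by ring
      _ ≤ 16 * (1 + 4 * t) ^ 2 * (1 + t) ^ 2 := mul_le_mul_of_nonneg_left (by nlinarith) (by positivity)
      _ = (4 * (1 + 4 * t) * (1 + t)) ^ 2 := by ring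

section Pairings

variable {n L : ℕ} [NeZero L] {R' : Finset (Fin (d + 1) → ℤ)}

/-- **B4 COROLLARY 2.3 (2.30) FOR THE TWO-CUTOFF LINE — ALL FOUR PAIRINGS, SET FORM**: for `a > 0`, `n ≥ 1`, `R′` a union of `nL`-blocks,
`0 ≤ δ ≤ 1` in the mesh-free window, `s ∈ [0,1]`, `supp f ⊆ S`, `supp f′ ⊆ T`, `dist_η(S,T) ≥ ρ₀`, `G = (twoCutoffLine s)⁻¹`:
`|⟨f,Gf′⟩|, |⟨f,D_μGf′⟩|, |⟨f,GD_ν^⊤f′⟩|, |⟨f,D_μGD_ν^⊤f′⟩| ≤ c_L·e^{−δρ₀}·‖f‖₂‖f′‖₂` with `c_L = 4(1 + 4∕σ)(1 + 1∕σ)`, `σ = min(2,a)∕L^{d+1}`.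
[cite: Balaban1983RegularityDecay, p. 580 Corollary 2.3 (2.30), case A = 0, for the two-cutoff line] [folklore] -/
theorem cor23_line_pairings_set (hn : 1 ≤ n) (hR' : IsBlockUnion (n * L) R') {a δ : ℝ} (ha : 0 < a) (hδ0 : 0 ≤ δ) (hδ1 : δ ≤ 1)
    (hsmall : 2 * (2 * ((d : ℝ) + 1) * (δ * L) ^ 2 + a * (Real.exp δ - 1)) ≤ (min 2 a / (L : ℝ) ^ (d + 1)) / 2)
    {s : ℝ} (hs0 : 0 ≤ s) (hs1 : s ≤ 1) (S T : Finset ↥(R'.image (blk L))) (ρ₀ : ℝ)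
    (hρ₀ : ∀ x ∈ S, ∀ t ∈ T, ρ₀ ≤ edistR n (R'.image (blk L)) x t) (f f' : ↥(R'.image (blk L)) → ℝ)
    (hf : ∀ x, x ∉ S → f x = 0) (hf' : ∀ x, x ∉ T → f' x = 0) (μ ν : Fin (d + 1)) :
    |f ⬝ᵥ (twoCutoffLine (isBlockUnion_fine hR') n a s)⁻¹.mulVec f'| ≤
        cL (min 2 a / (L : ℝ) ^ (d + 1)) * Real.exp (-(δ * ρ₀)) * l2n f * l2n f'
    ∧ |f ⬝ᵥ fdiff n (R'.image (blk L)) μ ((twoCutoffLine (isBlockUnion_fine hR') n a s)⁻¹.mulVec f')| ≤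
        cL (min 2 a / (L : ℝ) ^ (d + 1)) * Real.exp (-(δ * ρ₀)) * l2n f * l2n f'
    ∧ |f ⬝ᵥ (twoCutoffLine (isBlockUnion_fine hR') n a s)⁻¹.mulVec (fdiffT n (R'.image (blk L)) ν f')| ≤
        cL (min 2 a / (L : ℝ) ^ (d + 1)) * Real.exp (-(δ * ρ₀)) * l2n f * l2n f'
    ∧ |f ⬝ᵥ fdiff n (R'.image (blk L)) μ
          ((twoCutoffLine (isBlockUnion_fine hR') n a s)⁻¹.mulVec (fdiffT n (R'.image (blk L)) ν f'))| ≤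
        cL (min 2 a / (L : ℝ) ^ (d + 1)) * Real.exp (-(δ * ρ₀)) * l2n f * l2n f' := by
  have hL0 : (0 : ℝ) < L := by exact_mod_cast (NeZero.one_le : 1 ≤ L)
  set σ : ℝ := min 2 a / (L : ℝ) ^ (d + 1) with hσdef
  have hσ : 0 < σ := div_pos (lt_min (by norm_num) ha) (by positivity)
  obtain ⟨k1, k2, k3⟩ := consts_le_cL_sq hσ hδ0 hδ1
  have hc : 0 ≤ cL σ * Real.exp (-(δ * ρ₀)) := (mul_pos (cL_pos hσ) (Real.exp_pos _)).le
  have hB : 0 ≤ ∑ j, f' j ^ 2 := Finset.sum_nonneg fun j _ => sq_nonneg _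
  have hexp : Real.exp (-(2 * (δ * ρ₀))) = Real.exp (-(δ * ρ₀)) ^ 2 := by
    rw [← Real.exp_nat_mul]; push_cast; ring_nf
  have hCsq : (cL σ * Real.exp (-(δ * ρ₀))) ^ 2 = cL σ ^ 2 * Real.exp (-(2 * (δ * ρ₀))) := by rw [hexp]; ring
  have he0 : 0 ≤ Real.exp (-(2 * (δ * ρ₀))) := (Real.exp_pos _).le
  have conv : ∀ {K : ℝ} {X : ↥(R'.image (blk L)) → ℝ}, K ≤ cL σ ^ 2 →
      ∑ x ∈ S, X x ^ 2 ≤ K * Real.exp (-(2 * (δ * ρ₀))) * ∑ j, f' j ^ 2 →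
      |f ⬝ᵥ X| ≤ cL σ * Real.exp (-(δ * ρ₀)) * l2n f * l2n f' := by
    intro K X hK hX
    have hX' : ∑ x ∈ S, X x ^ 2 ≤ (cL σ * Real.exp (-(δ * ρ₀))) ^ 2 * ∑ j, f' j ^ 2 := by
      rw [hCsq]
      exact hX.trans (mul_le_mul_of_nonneg_right (mul_le_mul_of_nonneg_right hK he0) hB)
    exact abs_dot_le_of_setSq f X S hf hc hX'
  -- the first pairing: file 86 (source may be empty)
  have h1 : ∑ x ∈ S, ((twoCutoffLine (isBlockUnion_fine hR') n a s)⁻¹.mulVec f') x ^ 2 ≤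
      (2 / σ) ^ 2 * Real.exp (-(2 * (δ * ρ₀))) * ∑ j, f' j ^ 2 := by
    by_cases hT : T.Nonempty
    · exact (twoCutoff_inv_setDecay hn hR' ha hδ0 hδ1 hsmall hs0 hs1 S T hT ρ₀ hρ₀ f' hf').2
    · have h0 : f' = 0 := funext fun x => hf' x fun hx => hT ⟨x, hx⟩
      rw [h0, Matrix.mulVec_zero]
      simp only [Pi.zero_apply]
      norm_num
  exact ⟨conv k1 h1,
    conv k2 (twoCutoff_dinv_setDecay hn hR' ha hδ0 hδ1 hsmall hs0 hs1 S T ρ₀ hρ₀ f' hf' μ),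
    conv k2 (twoCutoff_invT_setDecay hn hR' ha hδ0 hδ1 hsmall hs0 hs1 S T ρ₀ hρ₀ ν f' hf'),
    conv k3 (twoCutoff_dinvT_setDecay hn hR' ha hδ0 hδ1 hsmall hs0 hs1 S T ρ₀ hρ₀ μ ν f' hf')⟩

end Pairings

/-! ### §3 The printed quantifier shape: one pair `(c_L, δ₀)` per window, every mesh, every `s`, every region, every `f, f′` -/

section Printed

open Literature.MathematicalPhysics.QuantumFieldTheory.Balaban1983to89.B4Cor23Zero (supp suppDist suppDist_le eq_zero_of_not_mem_supp)
open NE7K1LinRegionLine (lineRate lineRate_pos lineRate_le_one lineRate_small)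

variable {n L : ℕ} [NeZero L] {R' : Finset (Fin (d + 1) → ℤ)}

/-- **B4 COROLLARY 2.3 (2.30) FOR THE TWO-CUTOFF LINE — ALL FOUR PAIRINGS, PRINTED QUANTIFIER SHAPE** («there exist positive constants
c₀, δ₀ such that for arbitrary scalar field configurations f, f′ …»): for every dimension `d + 1`, two-run refinement `L ≥ 1` and window
`0 < a₋ ≤ a₊`, the EXPLICIT `c_L = 4(1 + 4∕σ₋)(1 + 1∕σ₋)` (`σ₋ = min(2,a₋)∕L^{d+1}`) and `δ₀ = lineRate d L a₋ a₊` serve EVERY mesh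
`η = 1∕n`, EVERY `s ∈ [0,1]`, EVERY `a ∈ [a₋,a₊]`, EVERY union `R′` of `nL`-blocks, EVERY `f, f′` and all `μ, ν`:
`|⟨f,Gf′⟩|, |⟨f,D_μGf′⟩|, |⟨f,GD_ν^⊤f′⟩|, |⟨f,D_μGD_ν^⊤f′⟩| ≤ c_L·e^{−δ₀·dist_η(supp f, supp f′)}·‖f‖₂‖f′‖₂`, `G = (twoCutoffLine s)⁻¹`.
[cite: Balaban1983RegularityDecay, p. 580–581 Corollary 2.3 (2.30), case A = 0, for the two-cutoff line] [folklore] -/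
theorem cor23_line_main (hn : 1 ≤ n) (hR' : IsBlockUnion (n * L) R') {amin aplus a : ℝ} (ha : 0 < amin) (h1 : amin ≤ a)
    (h2 : a ≤ aplus) {s : ℝ} (hs0 : 0 ≤ s) (hs1 : s ≤ 1) (f f' : ↥(R'.image (blk L)) → ℝ) (μ ν : Fin (d + 1)) :
    |f ⬝ᵥ (twoCutoffLine (isBlockUnion_fine hR') n a s)⁻¹.mulVec f'| ≤
        cL (min 2 amin / (L : ℝ) ^ (d + 1)) * Real.exp (-(lineRate d L amin aplus * suppDist n (R'.image (blk L)) f f')) * l2n f * l2n f'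
    ∧ |f ⬝ᵥ fdiff n (R'.image (blk L)) μ ((twoCutoffLine (isBlockUnion_fine hR') n a s)⁻¹.mulVec f')| ≤
        cL (min 2 amin / (L : ℝ) ^ (d + 1)) * Real.exp (-(lineRate d L amin aplus * suppDist n (R'.image (blk L)) f f')) * l2n f * l2n f'
    ∧ |f ⬝ᵥ (twoCutoffLine (isBlockUnion_fine hR') n a s)⁻¹.mulVec (fdiffT n (R'.image (blk L)) ν f')| ≤
        cL (min 2 amin / (L : ℝ) ^ (d + 1)) * Real.exp (-(lineRate d L amin aplus * suppDist n (R'.image (blk L)) f f')) * l2n f * l2n f'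
    ∧ |f ⬝ᵥ fdiff n (R'.image (blk L)) μ
          ((twoCutoffLine (isBlockUnion_fine hR') n a s)⁻¹.mulVec (fdiffT n (R'.image (blk L)) ν f'))| ≤
        cL (min 2 amin / (L : ℝ) ^ (d + 1)) * Real.exp (-(lineRate d L amin aplus * suppDist n (R'.image (blk L)) f f')) *
          l2n f * l2n f' := by
  have hL : 1 ≤ L := NeZero.one_le
  have hL0 : (0 : ℝ) < L := by exact_mod_cast hL
  have ha0 : 0 < a := lt_of_lt_of_le ha h1
  set δ := lineRate d L amin aplus with hδ
  have hδ0 : 0 < δ := lineRate_pos d hL aplus ha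
  have hδ1 : δ ≤ 1 := lineRate_le_one d L amin aplus
  have hsmall := lineRate_small d hL ha h1 h2
  set ρ₀ := suppDist n (R'.image (blk L)) f f' with hρ₀
  set σ : ℝ := min 2 a / (L : ℝ) ^ (d + 1) with hσ
  set σm : ℝ := min 2 amin / (L : ℝ) ^ (d + 1) with hσm
  have hσ0 : 0 < σ := div_pos (lt_min (by norm_num) ha0) (by positivity)
  have hσm0 : 0 < σm := div_pos (lt_min (by norm_num) ha) (by positivity)
  have hσle : σm ≤ σ := div_le_div_of_nonneg_right (min_le_min le_rfl h1) (by positivity)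
  -- `c_L` is antitone in `σ`
  have hC : cL σ ≤ cL σm := by
    unfold cL
    have i1 : 4 / σ ≤ 4 / σm := div_le_div_of_nonneg_left (by norm_num) hσm0 hσle
    have i2 : 1 / σ ≤ 1 / σm := div_le_div_of_nonneg_left (by norm_num) hσm0 hσle
    have p1 : 0 ≤ 1 + 4 / σ := by positivity
    have p2 : 0 ≤ 1 + 1 / σ := by positivity
    calc 4 * (1 + 4 / σ) * (1 + 1 / σ) ≤ 4 * (1 + 4 / σm) * (1 + 1 / σ) :=
          mul_le_mul_of_nonneg_right (mul_le_mul_of_nonneg_left (by linarith) (by norm_num)) p2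
      _ ≤ 4 * (1 + 4 / σm) * (1 + 1 / σm) := mul_le_mul_of_nonneg_left (by linarith) (by positivity)
  have hset := cor23_line_pairings_set hn hR' ha0 hδ0.le hδ1 hsmall hs0 hs1 (supp f) (supp f') ρ₀
    (fun x hx t ht => suppDist_le f f' hx ht) f f' (eq_zero_of_not_mem_supp f) (eq_zero_of_not_mem_supp f') μ ν
  have hfg : 0 ≤ l2n f * l2n f' := mul_nonneg (Real.sqrt_nonneg _) (Real.sqrt_nonneg _)
  have hup : cL σ * Real.exp (-(δ * ρ₀)) * l2n f * l2n f' ≤ cL σm * Real.exp (-(δ * ρ₀)) * l2n f * l2n f' := by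
    have := mul_le_mul_of_nonneg_right (mul_le_mul_of_nonneg_right hC (Real.exp_pos (-(δ * ρ₀))).le) hfg
    linarith [this]
  obtain ⟨p1, p2, p3, p4⟩ := hset
  exact ⟨p1.trans hup, p2.trans hup, p3.trans hup, p4.trans hup⟩

/-- Sanity instance (explicit numbers): `d + 1 = 4`, `L = 2`, `a₋ = a₊ = a = 1` (`σ₋ = 1∕16`, `c_L = 4·65·17 = 4420`), mesh `η = 1∕7`,
`s = 1∕3`: for EVERY union `R′` of `14`-blocks of `ℤ⁴` and every `f, f′` on its `2`-block labels,
`|⟨f, D_0 G(⅓) D_1^⊤ f′⟩| ≤ 4420·e^{−lineRate(3,2,1,1)·dist_η(supp f, supp f′)}‖f‖₂‖f′‖₂`. -/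
example (R' : Finset (Fin (3 + 1) → ℤ)) (hR' : IsBlockUnion (7 * 2) R') (f f' : ↥(R'.image (blk 2)) → ℝ) :
    |f ⬝ᵥ fdiff 7 (R'.image (blk 2)) 0
        ((twoCutoffLine (isBlockUnion_fine hR') 7 1 (1 / 3))⁻¹.mulVec (fdiffT 7 (R'.image (blk 2)) 1 f'))|
      ≤ 4420 * Real.exp (-(lineRate 3 2 1 1 * suppDist 7 (R'.image (blk 2)) f f')) * l2n f * l2n f' := by
  have h := (cor23_line_main (d := 3) (by norm_num : 1 ≤ 7) hR' one_pos le_rfl le_rfl (by norm_num : (0 : ℝ) ≤ 1 / 3)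
    (by norm_num : (1 : ℝ) / 3 ≤ 1) f f' 0 1).2.2.2
  have hc : cL (min 2 (1 : ℝ) / ((2 : ℕ) : ℝ) ^ (3 + 1)) = 4420 := by
    unfold cL; rw [min_eq_right (by norm_num : (1 : ℝ) ≤ 2)]; norm_num
  rwa [hc] at h

end Printed

end Summit.QuantumFields.BalabanUV.T4Continuum.NE7K1LinSchurLineU1SetDeriv
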